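import Summits.CriticalPhenomena.CardyFormulaZ2.Theorems.CardyBoundaryCoulombGasRectilinearCardyStubRowBlocksPart16
import Summits.CriticalPhenomena.CardyFormulaZ2.Theorems.CardyBoundaryCoulombGasRectilinearCardyStubRowBlocksPart9
import Summits.CriticalPhenomena.CardyFormulaZ2.Theorems.CardyBoundaryCoulombGasRectilinearCardyStubRowBlocksPart6
import HarnessLib

/-!
# Stub B `stub_rowBlocks` of line `excursion-kernel-covariance`, part 17: the data at one mesh
# (crux `RectilinearCardy`, stmt-CriticalPhenomena-5660, route `CardyBoundaryCoulombGas`)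

The two mesh-dependent inputs of the two-block theorem `rb_main_blocks` (part 10):

* `rb_window_anchor` — for a boundary-row vertex `v` within `r/2` of a framed window point `∂D(t₀)`:
  the `d`-side row neighbour `X = v - dir (k₀ + 1)` of `v` is a row vertex (`rb_row_vertex`) with
  exterior dart `(X, k₀) = outDart V X` whose successor sits at `v` (`rb_dsucc_row`); the foot of
  `v` on the side is a frontier point `∂D(tv)` with `|tv - t₀| ≤ θ`, of height `Hw` and tangential
  coordinate `δ (tng X + s)`, within `2δ` of the mesh point of `X`;
* `rb_cycle_shift` — the boundary cycle of the BOUNDARY FEET stub re-started at a given exterior dart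
  `d₀` (`rb_shift_enum`, `rb_shift_nodup`), with its lifted feet renormalised by an integer so that
  the foot of `d₀` has parameter within `ε₂` of `tv` (`rb_foot_window`); all clauses are kept;
* small tools of the final transcription: `rb_sep_of_far` (vertices next to far-apart centres are
  `ℓ∞`-separated), `rb_ne_of_dist_ne` (a vertex at nonzero distance from `v` is not `v`),
  `rb_exists_steps` (an integer number of lattice steps between two lengths).

All [folklore].
-/

noncomputable section

open Set Metric
open Literature.Probability.RandomPlanarGeometry
open Literature.Probability.LatticeModels (Site meshPoint Orient)
open Literature.Probability.LatticeModels.CollarLegModel (Dart dartTip dir dsucc outDart neighbours)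
open Summit.CriticalPhenomena.CardyFormulaZ2.Cruxes.BoundaryDefectGaussianR.RainbowMonomialsInExcursionKernels (tp_dir_val)
open Literature.Probability.Percolation (site_eta)

namespace Summit.CriticalPhenomena.CardyFormulaZ2.Cruxes.RectilinearCardy.ExcursionKernelCovariance

/-! ### The anchor at the window -/

/-- A step back and a step forth along a row cancel: `x + dir (k + 3) + dir (k + 1) = x`. [folklore] -/
theorem rb_dir_back_forth (x : ℤ × ℤ) (k : Fin 4) : x + dir (k + 3) + dir (k + 1) = x := by
  obtain ⟨h0, h1, h2, h3⟩ := tp_dir_val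
  obtain ⟨a, b⟩ := x
  fin_cases k <;> simp [h0, h1, h2, h3]

/-- **The anchor at the window.** See the module docstring. [folklore] -/
theorem rb_window_anchor (R : ConformalRectangle) (D : JordanDomain) (hDc : D.carrier = R.carrier)
    {δ r θ Hw t₀ : ℝ} {V : Finset (ℤ × ℤ)} {ow : Orient} {kw : Fin 4} {sw : ℤ} (hδ : 0 < δ) (hrδ : 40 * δ ≤ r)
    (hV : ∀ x : ℤ × ℤ, x ∈ V ↔ meshPoint δ (![x.1, x.2] : Site 2) ∈ closure D.carrier)
    (hcl : ∀ z, dist z (D.boundary t₀) < r → (z ∈ closure D.carrier ↔ Hw ≤ Orient.nrmC ow z))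
    (hop : ∀ z, dist z (D.boundary t₀) < r → (z ∈ D.carrier ↔ Hw < Orient.nrmC ow z))
    (hnear : ∀ z ∈ frontier D.carrier, dist z (D.boundary t₀) < r → ∃ t, |t - t₀| ≤ θ ∧ D.boundary t = z)
    (htab : ∀ x : ℤ × ℤ, Orient.nrm ow (![(x + dir kw).1, (x + dir kw).2] : Site 2) = Orient.nrm ow (![x.1, x.2] : Site 2) - 1 ∧
      Orient.nrm ow (![(x + dir (kw + 1)).1, (x + dir (kw + 1)).2] : Site 2) = Orient.nrm ow (![x.1, x.2] : Site 2) ∧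
      Orient.nrm ow (![(x + dir (kw + 2)).1, (x + dir (kw + 2)).2] : Site 2) = Orient.nrm ow (![x.1, x.2] : Site 2) + 1 ∧
      Orient.nrm ow (![(x + dir (kw + 3)).1, (x + dir (kw + 3)).2] : Site 2) = Orient.nrm ow (![x.1, x.2] : Site 2) ∧
      Orient.tng ow (![(x + dir (kw + 1)).1, (x + dir (kw + 1)).2] : Site 2) = Orient.tng ow (![x.1, x.2] : Site 2) + sw ∧
      Orient.tng ow (![(x + dir (kw + 3)).1, (x + dir (kw + 3)).2] : Site 2) = Orient.tng ow (![x.1, x.2] : Site 2) - sw)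
    (hk₀ : ∀ (x : ℤ × ℤ) (k : Fin 4), Orient.nrm ow (![x.1, x.2] : Site 2) - 1 ≤ Orient.nrm ow (![(x + dir k).1, (x + dir k).2] : Site 2) ∧
      (Orient.nrm ow (![(x + dir k).1, (x + dir k).2] : Site 2) = Orient.nrm ow (![x.1, x.2] : Site 2) - 1 ↔ k = kw))
    {v : Site 2} (hv : v ∈ boundaryRow R δ) (hvd : dist (meshPoint δ v) (D.boundary t₀) ≤ r / 2) :
    ∃ (X : ℤ × ℤ) (tv : ℝ), X + dir (kw + 1) = ((v 0, v 1) : ℤ × ℤ) ∧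
      (X ∈ V ∧ X + dir kw ∉ V ∧ ((neighbours X).filter (fun y ↦ y ∉ V)).card = 1 ∧ outDart V X = some (X, kw)) ∧
      dsucc V (X, kw) = (((v 0, v 1) : ℤ × ℤ), kw) ∧
      Orient.nrm ow (![X.1, X.2] : Site 2) = ⌈Hw / δ⌉ ∧ Orient.nrm ow v = ⌈Hw / δ⌉ ∧ |tv - t₀| ≤ θ ∧
      D.boundary tv = (((δ * (Orient.tng ow v : ℝ) : ℝ)) : ℂ) * Orient.e ow + ((Hw : ℝ) : ℂ) * Orient.ν ow ∧
      Orient.nrmC ow (D.boundary tv) = Hw ∧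
      Orient.tngC ow (D.boundary tv) = δ * ((Orient.tng ow (![X.1, X.2] : Site 2) + sw : ℤ) : ℝ) ∧
      dist (meshPoint δ (![X.1, X.2] : Site 2)) (D.boundary tv) < 2 * δ ∧
      dist (meshPoint δ (![X.1, X.2] : Site 2)) (meshPoint δ v) = δ := by
  have hclR : ∀ z, dist z (D.boundary t₀) < r → (z ∈ closure R.carrier ↔ Hw ≤ Orient.nrmC ow z) := by
    rw [← hDc]; exact hcl
  have hvn : Orient.nrm ow v = ⌈Hw / δ⌉ := kwl_nrm_eq_of_mem_boundaryRow R hclR hδ hv (by linarith)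
  have hvsite : (![((v 0, v 1) : ℤ × ℤ).1, ((v 0, v 1) : ℤ × ℤ).2] : Site 2) = v := site_eta v
  obtain ⟨X, hX⟩ : ∃ X : ℤ × ℤ, X = ((v 0, v 1) : ℤ × ℤ) + dir (kw + 3) := ⟨_, rfl⟩
  have hXv : X + dir (kw + 1) = ((v 0, v 1) : ℤ × ℤ) := by rw [hX]; exact rb_dir_back_forth _ kw
  have hXn : Orient.nrm ow (![X.1, X.2] : Site 2) = ⌈Hw / δ⌉ := by
    rw [hX, (htab _).2.2.2.1, hvsite, hvn]
  have htng : Orient.tng ow v = Orient.tng ow (![X.1, X.2] : Site 2) + sw := by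
    have := (htab X).2.2.2.2.1
    rw [hXv, hvsite] at this
    exact this
  have hdXv : dist (meshPoint δ (![X.1, X.2] : Site 2)) (meshPoint δ v) = δ := by
    have := rb_dist_mesh_dir hδ X (kw + 1)
    rw [hXv, hvsite, dist_comm] at this
    exact this
  have hXc : dist (meshPoint δ (![X.1, X.2] : Site 2)) (D.boundary t₀) ≤ r / 2 + δ := by
    have := dist_triangle (meshPoint δ (![X.1, X.2] : Site 2)) (meshPoint δ v) (D.boundary t₀)
    linarith
  obtain ⟨hXV, hXout, -, hXcard, hXod⟩ := rb_row_vertex hV hδ hcl hk₀ (x := X) (by linarith) hXn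
  have hdsucc : dsucc V (X, kw) = (((v 0, v 1) : ℤ × ℤ), kw) := by
    rw [rb_dsucc_row hV hδ hcl hk₀ (fun x => (htab x).2.1) (by linarith) hXn, hXv]
  -- the foot of `v`
  obtain ⟨hm1, hm2⟩ := kwl_ceil_bounds (h := Hw) hδ
  have htp : Orient.tngC ow (meshPoint δ v) = δ * (Orient.tng ow v : ℝ) := Orient.tngC_meshPoint ow δ v
  have hnp : Orient.nrmC ow (meshPoint δ v) = δ * (⌈Hw / δ⌉ : ℝ) := by rw [Orient.nrmC_meshPoint, hvn]
  have hpf : dist (meshPoint δ v) ((((δ * (Orient.tng ow v : ℝ) : ℝ)) : ℂ) * Orient.e ow + ((Hw : ℝ) : ℂ) * Orient.ν ow) =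
      δ * (⌈Hw / δ⌉ : ℝ) - Hw := by
    rw [← htp, kwl_dist_foot, hnp, abs_of_nonneg (by linarith)]
  have hfn : Orient.nrmC ow ((((δ * (Orient.tng ow v : ℝ) : ℝ)) : ℂ) * Orient.e ow + ((Hw : ℝ) : ℂ) * Orient.ν ow) = Hw :=
    Orient.nrmC_combo ow _ _
  have hft : Orient.tngC ow ((((δ * (Orient.tng ow v : ℝ) : ℝ)) : ℂ) * Orient.e ow + ((Hw : ℝ) : ℂ) * Orient.ν ow) =
      δ * (Orient.tng ow v : ℝ) := Orient.tngC_combo ow _ _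
  have hfvc : dist ((((δ * (Orient.tng ow v : ℝ) : ℝ)) : ℂ) * Orient.e ow + ((Hw : ℝ) : ℂ) * Orient.ν ow) (D.boundary t₀) < r := by
    have := dist_triangle ((((δ * (Orient.tng ow v : ℝ) : ℝ)) : ℂ) * Orient.e ow + ((Hw : ℝ) : ℂ) * Orient.ν ow)
      (meshPoint δ v) (D.boundary t₀)
    rw [dist_comm _ (meshPoint δ v), hpf] at this
    linarith
  have hffr := (rb_mem_frontier_iff_nrmC D.isOpen hcl hop hfvc).2 hfn
  obtain ⟨tv, htv, htvf⟩ := hnear _ hffr hfvc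
  refine ⟨X, tv, hXv, ⟨hXV, hXout, hXcard, hXod⟩, hdsucc, hXn, hvn, htv, htvf, by rw [htvf]; exact hfn, ?_, ?_, hdXv⟩
  · rw [htvf, hft, htng]
  · rw [htvf]
    have := dist_triangle (meshPoint δ (![X.1, X.2] : Site 2)) (meshPoint δ v)
      ((((δ * (Orient.tng ow v : ℝ) : ℝ)) : ℂ) * Orient.e ow + ((Hw : ℝ) : ℂ) * Orient.ν ow)
    linarith

/-! ### The boundary cycle re-started at a given dart -/

/-- **The boundary cycle re-started at `d₀`, feet renormalised.** See the module docstring. [folklore] -/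
theorem rb_cycle_shift (D : JordanDomain) {δ η ε₂ m₂ tv : ℝ} {V : Finset (ℤ × ℤ)} {e' : ℕ → Dart} {F' : ℕ → ℝ} {P : ℕ} {d₀ : Dart}
    (hper : ∀ n, e' (n + P) = e' n) (hsucc : ∀ n, e' (n + 1) = dsucc V (e' n))
    (hext : ∀ n, (e' n).1 ∈ V ∧ dartTip (e' n) ∉ V)
    (henum : ∀ d : Dart, d.1 ∈ V → dartTip d ∉ V → ∃ n, n < P ∧ e' n = d)
    (hnodup : ∀ n m, n < P → m < P → e' n = e' m → n = m)
    (hFmono : ∀ n, F' n ≤ F' (n + 1)) (hFP : ∀ n, F' (n + P) = F' n + 1)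
    (hFclose : ∀ n, dist (D.boundary (F' n)) (((e' n).1.1 : ℂ) * δ + ((e' n).1.2 : ℂ) * δ * Complex.I) ≤ η)
    (hcard2 : ∀ n, ((neighbours (e' n).1).filter (fun y ↦ y ∉ V)).card ≤ 2)
    (hcorner : ∀ n, (e' (n + 2)).1 = (e' (n + 1)).1 → (e' (n + 2)).2 = (e' (n + 1)).2 + 1 ∧
      e' n = ((e' (n + 1)).1 + dir ((e' (n + 1)).2 + 3), (e' (n + 1)).2) ∧
      e' (n + 3) = ((e' (n + 1)).1 + dir ((e' (n + 1)).2 + 2), (e' (n + 1)).2 + 1) ∧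
      ((neighbours (e' n).1).filter (fun y ↦ y ∉ V)).card = 1 ∧ ((neighbours (e' (n + 3)).1).filter (fun y ↦ y ∉ V)).card = 1)
    (hd₀ : d₀.1 ∈ V ∧ dartTip d₀ ∉ V)
    (htube : ∀ s t : ℝ, (∀ n : ℤ, ε₂ ≤ |s - t - n|) → m₂ ≤ dist (D.boundary s) (D.boundary t))
    (hdist : dist (meshPoint δ (![d₀.1.1, d₀.1.2] : Site 2)) (D.boundary tv) < 2 * δ) (hm : η + 2 * δ < m₂) :
    ∃ (e : ℕ → Dart) (F : ℕ → ℝ), e 0 = d₀ ∧ (∀ n, e (n + 1) = dsucc V (e n)) ∧ (∀ n, e (n + P) = e n) ∧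
      (∀ n, (e n).1 ∈ V ∧ dartTip (e n) ∉ V) ∧ (∀ d : Dart, d.1 ∈ V → dartTip d ∉ V → ∃ n, n < P ∧ e n = d) ∧
      (∀ n m, n < P → m < P → e n = e m → n = m) ∧ (∀ n, F n ≤ F (n + 1)) ∧ (∀ n, F (n + P) = F n + 1) ∧
      (∀ n, dist (D.boundary (F n)) (meshPoint δ (![(e n).1.1, (e n).1.2] : Site 2)) ≤ η) ∧
      |F 0 - tv| < ε₂ ∧
      (∀ n, ((neighbours (e n).1).filter (fun y ↦ y ∉ V)).card ≤ 2) ∧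
      (∀ n, (e (n + 2)).1 = (e (n + 1)).1 → (e (n + 2)).2 = (e (n + 1)).2 + 1 ∧
        e n = ((e (n + 1)).1 + dir ((e (n + 1)).2 + 3), (e (n + 1)).2) ∧
        e (n + 3) = ((e (n + 1)).1 + dir ((e (n + 1)).2 + 2), (e (n + 1)).2 + 1) ∧
        ((neighbours (e n).1).filter (fun y ↦ y ∉ V)).card = 1 ∧ ((neighbours (e (n + 3)).1).filter (fun y ↦ y ∉ V)).card = 1) := by
  obtain ⟨n₀, -, hn₀⟩ := henum d₀ hd₀.1 hd₀.2
  have hFclose' : ∀ n, dist (D.boundary (F' n)) (meshPoint δ (![(e' n).1.1, (e' n).1.2] : Site 2)) ≤ η := fun n => by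
    rw [← rb_mesh_eq]; exact hFclose n
  obtain ⟨k, hk⟩ := rb_foot_window D htube (hFclose' n₀) (by rw [hn₀]; exact hdist.le) hm
  refine ⟨fun n => e' (n₀ + n), fun n => F' (n₀ + n) - k, by simpa using hn₀, fun n => ?_, fun n => ?_, fun n => hext _,
    rb_shift_enum hper henum n₀, rb_shift_nodup hper hnodup n₀, fun n => ?_, fun n => ?_, fun n => ?_, ?_,
    fun n => hcard2 _, fun n h => ?_⟩
  · show e' (n₀ + (n + 1)) = dsucc V (e' (n₀ + n)); rw [← add_assoc, hsucc]
  · show e' (n₀ + (n + P)) = e' (n₀ + n); rw [← add_assoc, hper]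
  · show F' (n₀ + n) - k ≤ F' (n₀ + (n + 1)) - k
    have := hFmono (n₀ + n); rw [add_assoc] at this; linarith
  · show F' (n₀ + (n + P)) - k = F' (n₀ + n) - k + 1; rw [← add_assoc, hFP]; ring
  · show dist (D.boundary (F' (n₀ + n) - k)) (meshPoint δ (![(e' (n₀ + n)).1.1, (e' (n₀ + n)).1.2] : Site 2)) ≤ η
    have := D.periodic_boundary.sub_int_mul_eq k (x := F' (n₀ + n))
    rw [mul_one] at this
    rw [this]; exact hFclose' _
  · show |F' (n₀ + 0) - k - tv| < ε₂
    rw [add_zero, show F' n₀ - k - tv = F' n₀ - tv - k by ring]; exact hk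
  · obtain ⟨h1, h2, h3, h4, h5⟩ := hcorner (n₀ + n) (by simpa only [Nat.add_assoc] using h)
    exact ⟨by simpa only [Nat.add_assoc] using h1, by simpa only [Nat.add_assoc] using h2,
      by simpa only [Nat.add_assoc] using h3, h4, by simpa only [Nat.add_assoc] using h5⟩

/-! ### Small tools of the transcription -/

/-- **Vertices next to far-apart centres are `ℓ∞`-separated**: if the mesh points of `x`, `y` are
within `2δ` of centres `c`, `c'` with `dist c c' ≥ 8δ`, then `max |x₁ - y₁| |x₂ - y₂| ≥ 3`. [folklore] -/
theorem rb_sep_of_far {δ : ℝ} (hδ : 0 < δ) {x y : ℤ × ℤ} {c c' : ℂ}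
    (hx : dist (meshPoint δ (![x.1, x.2] : Site 2)) c < 2 * δ) (hy : dist (meshPoint δ (![y.1, y.2] : Site 2)) c' < 2 * δ)
    (hcc' : 8 * δ ≤ dist c c') : (3 : ℤ) ≤ max |x.1 - y.1| |x.2 - y.2| := by
  refine rb_sep_of_dist hδ ?_
  have h1 := dist_triangle c (meshPoint δ (![x.1, x.2] : Site 2)) c'
  have h2 := dist_triangle (meshPoint δ (![x.1, x.2] : Site 2)) (meshPoint δ (![y.1, y.2] : Site 2)) c'
  have h3 := dist_comm c (meshPoint δ (![x.1, x.2] : Site 2))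
  linarith

/-- A lattice point whose mesh point is at nonzero distance from that of the site `v` is not the
coordinate pair of `v`. [folklore] -/
theorem rb_ne_of_dist_ne {δ : ℝ} {x : ℤ × ℤ} {v : Site 2}
    (h : dist (meshPoint δ (![x.1, x.2] : Site 2)) (meshPoint δ v) ≠ 0) : x ≠ ((v 0, v 1) : ℤ × ℤ) := by
  rintro rfl
  exact h (by rw [show (![((v 0, v 1) : ℤ × ℤ).1, ((v 0, v 1) : ℤ × ℤ).2] : Site 2) = v from site_eta v, dist_self])

/-- **An integer number of lattice steps between two lengths**: if `0 ≤ a` and `a + 5δ ≤ b` then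
`a ≤ N δ` and `(N + 4) δ ≤ b` for some `N : ℕ`. [folklore] -/
theorem rb_exists_steps {δ a b : ℝ} (hδ : 0 < δ) (ha : 0 ≤ a) (h : a + 5 * δ ≤ b) :
    ∃ N : ℕ, a ≤ N * δ ∧ ((N : ℝ) + 4) * δ ≤ b := by
  refine ⟨⌈a / δ⌉₊, ?_, ?_⟩
  · have h1 := Nat.le_ceil (a / δ)
    rw [div_le_iff₀ hδ] at h1
    exact h1
  · have h1 := Nat.ceil_lt_add_one (show 0 ≤ a / δ by positivity)
    have h2 : (⌈a / δ⌉₊ : ℝ) * δ < (a / δ + 1) * δ := mul_lt_mul_of_pos_right h1 hδ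
    rw [add_mul, div_mul_cancel₀ _ hδ.ne'] at h2
    nlinarith

end Summit.CriticalPhenomena.CardyFormulaZ2.Cruxes.RectilinearCardy.ExcursionKernelCovariance

end
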